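import Literature.NumberTheory.EllipticCurves.CasselsTateLocalTerms
import HarnessLib

/-!
# The first case of the Cassels–Tate pairing at level `m`: the global sum and its independence of the choices

Topic `NumberTheory/EllipticCurves`; namespace `Literature.NumberTheory.EllipticCurves`. A structure,
definitions with bodies and theorems only: **no named fact is introduced** (D-0026). The two analytic
inputs of Milne's construction enter as explicit hypotheses: `hiso` (isotropy of the local Kummer
conditions at level `m²` for the level-`m²` Weil cup product — supplied from the named fact of
`KummerImageIsotropy.lean` by `weilLocalCup_eq_zero_of_mem_of_fact`) and `hPT : inv.SumLocalTermEqZero`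
(the reciprocity `∑_v inv_v = 0` on global classes for a family of local invariants at level `m²` —
supplied by the named fact `poitouTate_sum_localTatePairing_eq_zero`).

## What is formalised (Milne, *ADT* I, proof of Prop. 6.9, FIRST CASE, pp. 78–79)

For an elliptic curve `E/K` over a number field and a level `m ≥ 1`, with auxiliary level `m²`
(Milne allows any multiple of `m`; we fix `m²`, and write every local term at the single coefficient
level `μ_{m²}` using `⟨ι c, y⟩_{m²} = ⟨c, [m] y⟩`, file `WeilPairingLevelDescent`):

* `FirstCaseData W m`: the choices of Milne's first case — a Selmer lift `b ∈ Sel^{(m)}` of `a`, a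
  global lift `b₁ ∈ H¹(K, E[m²])` of `b` along `[m]` (exists iff `δ b = 0`: the first case), local
  lifts `β_v = b_{v,1} ∈ 𝓛_v^{(m²)}` of `loc_v b`, a Selmer lift `b'` of `a'` and local lifts
  `β'_v = b'_{v,1} ∈ 𝓛_v^{(m²)}` of `loc_v b'`;
* `FirstCaseData.value = ∑_v inv_v((loc_v b₁ - β_v) ∪_{m²} β'_v)` (Milne's `∑_v inv_v(c_v ∪ b'_v)` up
  to the global sign), the sum over the finite exceptional set `badSet` (all other terms vanish:
  `localTerm_eq_zero_of_not_mem_badSet`, `sum_localTerm_eq_value`);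
* **independence of all choices**: of the local lifts (`value_eq_of_eq`), of `b₁`
  (`value_eq_of_b_eq`: two lifts differ by `ι_* c₀` with `c₀ ∈ H¹(K, E[m])` GLOBAL, and
  `∑_v inv_v(loc_v(c₀ ∪_desc b')) = 0` by `hPT` — Milne's "obvious from (4.10)" step), of the Selmer
  lifts `b` (`value_eq_of_torsionH1ToH1_b_eq`: transport along a Kummer class `κ_m(Q)`, with
  `b₁ ↦ b₁ + κ_{m²}(Q₁)`, `m Q₁ = Q`) and `b'` (`value_eq_of_torsionH1ToH1_eq`: transport plus `hPT`
  at level `m²` and isotropy);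
* `exists_of_lift` (data exist in the first case), `value_add_right/left` (bi-additivity),
  `exists_of_selmer_sq` (the data of a divisible class `a = m a₀` have all local terms zero);
* `ctFirstCaseFun W m e … inv a a'`: the resulting FUNCTION of `(a, a')`, well defined
  (`ctFirstCaseFun_eq`), additive in each variable on pairs admitting data
  (`ctFirstCaseFun_add_right/left`), zero on `mШ × Ш[m]` (`ctFirstCaseFun_eq_zero_of_eq_smul`),
  with data existing in the first case (`exists_firstCaseData`).

Not formalised here (absent inputs, see the unit's NOTES): the general case of the definition
(`δ b ≠ 0`, Milne's 3-cochain `ε`), alternation (Rem. 6.11), and the converse kernel statement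
(Lemma 6.17 / Thm. 6.13(a): local duality for `E` and Poitou–Tate (a),(c) for `E[m]`).
Motivation: provefact `WeierstrassCurve.exists_casselsTate_pairing` (reduced by
`exists_casselsTate_pairing_of_levelwise` to the fixed-level theorem).

## References

* [MilneADT2006] J. S. Milne, *Arithmetic Duality Theorems*, 2nd ed. (2006), Ch. I §6, proof of
  Prop. 6.9 (pp. 78–79), Thm. 6.13(a).
* [SilvermanAEC2009] J. H. Silverman, *The Arithmetic of Elliptic Curves*, 2nd ed., GTM 106 (2009),
  Thm. X.4.14 (statement of the target fact), X.§4.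
-/

noncomputable section

open scoped Classical

universe u

namespace Literature.NumberTheory.EllipticCurves

open CategoryTheory _root_.WeierstrassCurve Field NumberField
open Literature.NumberTheory.GaloisRepresentations Literature.NumberTheory.GaloisCohomology
open Literature.NumberTheory.GaloisRepresentations.DiscreteGaloisModule (mu MuCarrier pairing)
open scoped ContRepresentation

-- Cup products need `LocallyCompactSpace Γ`; as in the tree's cup-product files, the compactness of
-- absolute Galois groups is a local instance only.
attribute [local instance] absoluteGaloisGroup_compactSpace

variable {K : Type u} [Field K] [NumberField K] (W : WeierstrassCurve K) (m : ℕ) [NeZero m]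

/-! ## The data of the first case -/

/-- **Data of the first case of the Cassels–Tate pairing at level `m`** (Milne, *ADT*, I, proof of
Prop. 6.9, first case, with the auxiliary level `m²` and all local lifts chosen):

* `b ∈ Sel^{(m)}(E/K) ⊆ H¹(K, E[m])` (a Selmer lift of `a ∈ Ш[m]`, `a = torsionH1ToH1 b`);
* `b₁ ∈ H¹(K, E[m²])` with `[m]_* b₁ = b` (exists iff the obstruction `δ b ∈ Ш²(K, E[m])` vanishes:
  the FIRST CASE);
* for every place `v`, `β_v = b_{v,1} ∈ 𝓛_v^{(m²)}` (local Kummer condition at level `m²`) with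
  `[m]_* β_v = loc_v b`;
* `b' ∈ Sel^{(m)}(E/K)` (a Selmer lift of `a'`), and for every `v`, `β'_v = b'_{v,1} ∈ 𝓛_v^{(m²)}` with
  `[m]_* β'_v = loc_v b'`.

[cite: MilneADT2006, Ch. I §6, proof of Prop. 6.9] -/
structure FirstCaseData where
  /-- the Selmer lift of `a` at level `m` -/
  b : galoisCohomology (W.torsionGaloisModule (m : ℤ)) 1
  b_mem : b ∈ selmerGroup W (m : ℤ)
  /-- the global lift of `b` to level `m²` -/
  b₁ : galoisCohomology (W.torsionGaloisModule ((m * m : ℕ) : ℤ)) 1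
  map_b₁ : galoisCohomology.map (mulK W m m) 1 b₁ = b
  /-- the local lifts of `loc_v b` inside the local Kummer condition at level `m²` -/
  β : (v : Place K) →
    galoisCohomology (GaloisRep.restrictField (Place.Completion v) (W.torsionGaloisModule ((m * m : ℕ) : ℤ))) 1
  β_mem : ∀ v, β v ∈ W.kummerLocalConditionAt ((m * m : ℕ) : ℤ) (Place.Completion v)
  map_β : ∀ v, galoisCohomology.map ((mulK W m m).restrictField (Place.Completion v)) 1 (β v) =
    galoisCohomology.res (W.torsionGaloisModule (m : ℤ)) (Place.Completion v) 1 b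
  /-- the Selmer lift of `a'` at level `m` -/
  b' : galoisCohomology (W.torsionGaloisModule (m : ℤ)) 1
  b'_mem : b' ∈ selmerGroup W (m : ℤ)
  /-- the local lifts of `loc_v b'` inside the local Kummer condition at level `m²` -/
  β' : (v : Place K) →
    galoisCohomology (GaloisRep.restrictField (Place.Completion v) (W.torsionGaloisModule ((m * m : ℕ) : ℤ))) 1
  β'_mem : ∀ v, β' v ∈ W.kummerLocalConditionAt ((m * m : ℕ) : ℤ) (Place.Completion v)
  map_β' : ∀ v, galoisCohomology.map ((mulK W m m).restrictField (Place.Completion v)) 1 (β' v) =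
    galoisCohomology.res (W.torsionGaloisModule (m : ℤ)) (Place.Completion v) 1 b'

namespace FirstCaseData

variable {W m}
variable (e : geomTorsion W ((m * m : ℕ) : ℤ) → geomTorsion W ((m * m : ℕ) : ℤ) → AlgebraicClosure K)
  (hμ : ∀ S T, e S T ^ (m * m) = 1)
  (hadd₁ : ∀ S₁ S₂ T, e (S₁ + S₂) T = e S₁ T * e S₂ T)
  (hadd₂ : ∀ S T₁ T₂, e S (T₁ + T₂) = e S T₁ * e S T₂)
  (hgal : ∀ (σ : absoluteGaloisGroup K) (S T : geomTorsion W ((m * m : ℕ) : ℤ)),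
    σ • e S T = e (σ • S) (σ • T))
variable (inv : LocalInvariants K (m * m)) (D : FirstCaseData W m)

/-- The local term of the data at the place `v`: `t_v = inv_v((loc_v b₁ - β_v) ∪_{m²} β'_v)`.
[cite: MilneADT2006, Ch. I §6, proof of Prop. 6.9] -/
def localTerm (v : Place K) : ZMod (m * m) :=
  ctLocalTerm W m (Place.Completion v) e hμ hadd₁ hadd₂ hgal (inv v) D.b₁ (D.β v) (D.β' v)

/-- `loc_v b₁` satisfies the local Kummer condition at level `m²` at every finite place outside a
finite set (tree `finite_setOf_localization_not_mem_kummerSelmerStructure`). [folklore] -/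
theorem finite_badFinite [W.IsElliptic] :
    {v : IsDedekindDomain.HeightOneSpectrum (𝓞 K) |
      galoisCohomology.res (W.torsionGaloisModule ((m * m : ℕ) : ℤ)) (Place.Completion (Sum.inr v)) 1
        D.b₁ ∉ W.kummerLocalConditionAt ((m * m : ℕ) : ℤ) (Place.Completion (Sum.inr v))}.Finite :=
  W.finite_setOf_localization_not_mem_kummerSelmerStructure
    (Int.natCast_ne_zero.mpr (NeZero.ne (m * m))) D.b₁

/-- **The exceptional set of the data**: all infinite places together with the finite places where
`loc_v b₁` is not in the local Kummer condition at level `m²` (a finite set of places; outside it all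
local terms vanish). [folklore] -/
def badSet [W.IsElliptic] : Finset (Place K) :=
  (Finset.univ : Finset (InfinitePlace K)).map ⟨Sum.inl, Sum.inl_injective⟩ ∪
    (D.finite_badFinite).toFinset.map ⟨Sum.inr, Sum.inr_injective⟩

/-- Outside the exceptional set, `loc_v b₁ ∈ 𝓛_v^{(m²)}`. [folklore] -/
theorem res_b₁_mem_of_not_mem_badSet [W.IsElliptic] {v : Place K} (hv : v ∉ D.badSet) :
    galoisCohomology.res (W.torsionGaloisModule ((m * m : ℕ) : ℤ)) (Place.Completion v) 1 D.b₁ ∈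
      W.kummerLocalConditionAt ((m * m : ℕ) : ℤ) (Place.Completion v) := by
  rcases v with w | v
  · exact (hv (Finset.mem_union_left _ (Finset.mem_map.mpr ⟨w, Finset.mem_univ _, rfl⟩))).elim
  · by_contra h
    exact hv (Finset.mem_union_right _ (Finset.mem_map.mpr
      ⟨v, (D.finite_badFinite).mem_toFinset.mpr h, rfl⟩))

/-- **The value of the data**: `∑_v t_v`, the sum taken over the exceptional set (all other terms
vanish, `localTerm_eq_zero_of_not_mem_badSet`). [cite: MilneADT2006, Ch. I §6, proof of Prop. 6.9] -/
def value [W.IsElliptic] : ZMod (m * m) :=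
  ∑ v ∈ D.badSet, D.localTerm e hμ hadd₁ hadd₂ hgal inv v

variable {e hμ hadd₁ hadd₂ hgal}
variable (hiso : ∀ (v : Place K)
    ⦃x y : galoisCohomology (GaloisRep.restrictField (Place.Completion v)
      (W.torsionGaloisModule ((m * m : ℕ) : ℤ))) 1⦄,
    x ∈ W.kummerLocalConditionAt ((m * m : ℕ) : ℤ) (Place.Completion v) →
      y ∈ W.kummerLocalConditionAt ((m * m : ℕ) : ℤ) (Place.Completion v) →
        weilLocalCup W m (Place.Completion v) e hμ hadd₁ hadd₂ hgal x y = 0)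
include hiso

/-- **The local terms vanish outside the exceptional set** (isotropy at the good places).
[cite: MilneADT2006, Ch. I §6, proof of Prop. 6.9] -/
theorem localTerm_eq_zero_of_not_mem_badSet [W.IsElliptic] {v : Place K} (hv : v ∉ D.badSet) :
    D.localTerm e hμ hadd₁ hadd₂ hgal inv v = 0 :=
  ctLocalTerm_eq_zero_of_mem (inv v) (hiso v) (D.res_b₁_mem_of_not_mem_badSet hv) (D.β_mem v)
    (D.β'_mem v)

/-- **The value is the sum over any finite set of places containing the exceptional set.**
[folklore] -/
theorem sum_localTerm_eq_value [W.IsElliptic] {S : Finset (Place K)} (hS : D.badSet ⊆ S) :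
    ∑ v ∈ S, D.localTerm e hμ hadd₁ hadd₂ hgal inv v = D.value e hμ hadd₁ hadd₂ hgal inv := by
  rw [value, ← Finset.sum_subset hS fun v _ hv => D.localTerm_eq_zero_of_not_mem_badSet inv hiso hv]

/-! ## Independence of the local lifts -/

omit [NeZero m] hiso in
/-- `[m]_* loc_v b₁ = loc_v b` for the data. [folklore] -/
theorem map_mulK_res_b₁ (v : Place K) :
    galoisCohomology.map ((mulK W m m).restrictField (Place.Completion v)) 1
        (galoisCohomology.res (W.torsionGaloisModule ((m * m : ℕ) : ℤ)) (Place.Completion v) 1 D.b₁) =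
      galoisCohomology.res (W.torsionGaloisModule (m : ℤ)) (Place.Completion v) 1 D.b := by
  rw [← galoisCohomology.res_map_one, D.map_b₁]

/-- **Independence of the local lifts**: two data with the same global classes `b`, `b₁`, `b'` have
the same local terms (`ctLocalTerm_congr_mid`, `ctLocalTerm_congr_right`).
[cite: MilneADT2006, Ch. I §6, proof of Prop. 6.9] -/
theorem localTerm_eq_of_eq {D D₂ : FirstCaseData W m} (hb : D.b = D₂.b) (hb₁ : D.b₁ = D₂.b₁)
    (hb' : D.b' = D₂.b') (v : Place K) :
    D.localTerm e hμ hadd₁ hadd₂ hgal inv v = D₂.localTerm e hμ hadd₁ hadd₂ hgal inv v := by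
  rw [localTerm, localTerm, ← hb₁]
  rw [ctLocalTerm_congr_mid (inv v) (hiso v) D.b₁ (D.β_mem v) (D₂.β_mem v) (D.β'_mem v)]
  refine ctLocalTerm_congr_right (inv v) D.b₁ ?_ ?_
  · rw [D₂.map_β, D.map_mulK_res_b₁, hb]
  · rw [D.map_β', D₂.map_β', hb']

/-- Hence two data with the same global classes have the same value. [folklore] -/
theorem value_eq_of_eq [W.IsElliptic] {D D₂ : FirstCaseData W m} (hb : D.b = D₂.b)
    (hb₁ : D.b₁ = D₂.b₁) (hb' : D.b' = D₂.b') :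
    D.value e hμ hadd₁ hadd₂ hgal inv = D₂.value e hμ hadd₁ hadd₂ hgal inv := by
  rw [← D.sum_localTerm_eq_value inv hiso (Finset.subset_union_left (s₂ := D₂.badSet)),
    ← D₂.sum_localTerm_eq_value inv hiso (Finset.subset_union_right (s₁ := D.badSet))]
  exact Finset.sum_congr rfl fun v _ => localTerm_eq_of_eq inv hiso hb hb₁ hb' v

/-! ## Independence of the global lift `b₁` -/

omit [NumberField K] hiso in
/-- `E[m]` is finite (local instance, from the tree's `finite_geomTorsion_of_neZero`). [folklore] -/
theorem finite_geomTorsion_level [W.IsElliptic] : Finite (geomTorsion W (m : ℤ)) :=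
  finite_geomTorsion_of_neZero W m

attribute [local instance] finite_geomTorsion_level

omit [NumberField K] [NeZero m] hiso in
/-- `E[m]` is killed by `m²`. [folklore] -/
theorem mul_nsmul_geomTorsion_eq_zero (P : geomTorsion W (m : ℤ)) : (m * m) • P = 0 := by
  rw [mul_nsmul', AddSubgroup.torsionBy.nsmul P, nsmul_zero]

omit hiso in
/-- **The correction term of a change of `b₁` is a localised GLOBAL cup product**: for
`c₀ ∈ H¹(K, E[m])` and the data's `β'_v` (a lift of `loc_v b'` along `[m]`),
`inv_v(loc_v(ι_* c₀) ∪_{m²} β'_v) = inv_v(loc_v(c₀ ∪_desc b'))`. [folklore] -/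
theorem inv_weilLocalCup_res_map_inclKD (v : Place K)
    (invE : galoisCohomology (GaloisRep.restrictField (Place.Completion v) (mu K (m * m))) 2 →+ ZMod (m * m))
    (c₀ : galoisCohomology (W.torsionGaloisModule (m : ℤ)) 1) :
    invE (weilLocalCup W m (Place.Completion v) e hμ hadd₁ hadd₂ hgal
        (galoisCohomology.res (W.torsionGaloisModule ((m * m : ℕ) : ℤ)) (Place.Completion v) 1
          (galoisCohomology.map (inclKD W m m) 1 c₀)) (D.β' v)) =
      invE (galoisCohomology.localization (mu K (m * m)) v 2
        ((descendPairing W m m e hμ hadd₁ hadd₂ hgal).cupProduct c₀ D.b')) := by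
  congr 1
  rw [galoisCohomology.res_map_one, weilLocalCup_apply, cupProduct_restrict_weil_map_inclKD_eq_descend,
    D.map_β']
  exact (ContPairing.cupProduct_res (descendPairing W m m e hμ hadd₁ hadd₂ hgal)
    (absGaloisRestrict K (Place.Completion v)) c₀ D.b').symm

-- `hPT` is NOT a named fact: it is the reciprocity PREDICATE `LocalInvariants.SumLocalTermEqZero` on
-- the chosen family `inv` of local invariants at level `m²` (an honest hypothesis of Milne's
-- well-definedness argument, "obvious from (4.10)"); it is supplied by the existing named fact
-- `poitouTate_sum_localTatePairing_eq_zero` (file `GaloisCohomology/PoitouTate.lean`) by the user.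
variable (hPT : inv.SumLocalTermEqZero)
include hPT

/-- **Independence of the global lift `b₁`** (and of the local lifts): two data with the same Selmer
lifts `b`, `b'` have the same value. The two lifts `b₁` differ by `ι_* c₀` for a global
`c₀ ∈ H¹(K, E[m])` (exactness of `H¹(E[m]) → H¹(E[m²]) → H¹(E[m])`); the local terms then differ by
`inv_v(loc_v(c₀ ∪_desc b'))`, whose sum vanishes by the Poitou–Tate reciprocity for the global classes
`c₀, b'` (Milne: "the difference of two definitions is `∑_v inv_v(c_v ∪ b'_v)` for a GLOBAL
`c ∈ H¹(K, A_m)`, which is zero by Thm. 4.10(b)"). [cite: MilneADT2006, Ch. I §6, proof of Prop. 6.9] -/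
theorem value_eq_of_b_eq [W.IsElliptic] {D D₂ : FirstCaseData W m} (hb : D.b = D₂.b) (hb' : D.b' = D₂.b') :
    D.value e hμ hadd₁ hadd₂ hgal inv = D₂.value e hμ hadd₁ hadd₂ hgal inv := by
  -- normalise the local lifts of `D₂` to those of `D`
  let D₃ : FirstCaseData W m :=
    { b := D₂.b, b_mem := D₂.b_mem, b₁ := D₂.b₁, map_b₁ := D₂.map_b₁
      β := D.β, β_mem := D.β_mem, map_β := fun v => by rw [D.map_β, hb]
      b' := D.b', b'_mem := D.b'_mem, β' := D.β', β'_mem := D.β'_mem, map_β' := D.map_β' }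
  have h23 : D₂.value e hμ hadd₁ hadd₂ hgal inv = D₃.value e hμ hadd₁ hadd₂ hgal inv :=
    value_eq_of_eq inv hiso rfl rfl hb'.symm
  rw [h23]
  -- `D₃.b₁ - D.b₁ = ι_* c₀`
  have hδ : galoisCohomology.map (mulK W m m) 1 (D₃.b₁ - D.b₁) = 0 := by
    rw [map_sub, D.map_b₁, show D₃.b₁ = D₂.b₁ from rfl, D₂.map_b₁, hb, sub_self]
  obtain ⟨c₀, hc₀⟩ := (torsion_isSES_nat W m).exists_map_one_eq_of_map_one_eq_zero (D₃.b₁ - D.b₁) hδ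
  rw [DiscreteGaloisModule.cohomologyMap_homOfIntertwining] at hc₀
  -- compare over the common finite set of places
  let S := D.badSet ∪ D₃.badSet
  have hS : D.badSet ⊆ S := Finset.subset_union_left
  have hS₃ : D₃.badSet ⊆ S := Finset.subset_union_right
  rw [← D.sum_localTerm_eq_value inv hiso hS, ← D₃.sum_localTerm_eq_value inv hiso hS₃]
  -- termwise: `t³_v = t_v + inv_v(loc_v(c₀ ∪_desc b'))`
  have hterm : ∀ v, D₃.localTerm e hμ hadd₁ hadd₂ hgal inv v =
      D.localTerm e hμ hadd₁ hadd₂ hgal inv v +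
        inv v (galoisCohomology.localization (mu K (m * m)) v 2
          ((descendPairing W m m e hμ hadd₁ hadd₂ hgal).cupProduct c₀ D.b')) := fun v => by
    rw [localTerm, localTerm, show D₃.β v = D.β v from rfl, show D₃.β' v = D.β' v from rfl,
      show D₃.b₁ = D.b₁ + (D₃.b₁ - D.b₁) by abel, ctLocalTerm_add_global, ← hc₀]
    congr 1
    exact D.inv_weilLocalCup_res_map_inclKD v (inv v) c₀
  rw [Finset.sum_congr rfl fun v _ => hterm v, Finset.sum_add_distrib, left_eq_add]
  -- Poitou–Tate for the global classes `c₀, b'`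
  refine DiscreteGaloisModule.sum_inv_localization_cupProduct_pairing_eq_zero
    (ρ₁ := W.torsionGaloisModule (m : ℤ)) (ρ₂ := W.torsionGaloisModule (m : ℤ))
    (B := descendHom W m m e hμ hadd₁ hadd₂)
    (fun σ S T => descendHom_smul W m m e hμ hadd₁ hadd₂ hgal σ S T) inv hPT
    (mul_nsmul_geomTorsion_eq_zero (W := W) (m := m)) c₀ D.b' S fun v hv => ?_
  -- outside `S` both local terms vanish, hence so does their difference
  have h1 := D.localTerm_eq_zero_of_not_mem_badSet inv hiso (fun h => hv (hS h))
  have h3 := D₃.localTerm_eq_zero_of_not_mem_badSet inv hiso (fun h => hv (hS₃ h))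
  rw [hterm v, h1, zero_add] at h3
  exact h3

/-! ## Independence of the Selmer lift `b` of `a` -/

omit [NumberField K] [NeZero m] hiso hPT in
/-- `torsionH1ToH1` on a difference of classes typed in `galoisCohomology` (bridging the
definitional equality `galH1Torsion W n = galoisCohomology (W.torsionGaloisModule n) 1`). [folklore] -/
theorem torsionH1ToH1_sub' {n : ℤ} (x y : galoisCohomology (W.torsionGaloisModule n) 1) :
    torsionH1ToH1 W n (x - y) = torsionH1ToH1 W n x - torsionH1ToH1 W n y :=
  map_sub (torsionH1ToH1 W n) x y

omit [NumberField K] [NeZero m] hiso hPT in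
/-- `torsionH1ToH1` on a sum of classes typed in `galoisCohomology`. [folklore] -/
theorem torsionH1ToH1_add' {n : ℤ} (x y : galoisCohomology (W.torsionGaloisModule n) 1) :
    torsionH1ToH1 W n (x + y) = torsionH1ToH1 W n x + torsionH1ToH1 W n y :=
  map_add (torsionH1ToH1 W n) x y


omit hiso hPT in
/-- **A class of `H¹(K, E[n])` dying in `H¹(K, E)` is a Kummer class** `[σ ↦ σQ - Q]` with `n • Q`
rational (exactness of the Kummer sequence; tree `mem_range_kummerMapTorsion_of_torsionH1ToH1_eq_zero`).
[folklore] -/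
theorem exists_eq_kummerClassTorsion_of_torsionH1ToH1_eq_zero {n : ℤ} (hn : n ≠ 0)
    {ξ : galoisCohomology (W.torsionGaloisModule n) 1} (hξ : torsionH1ToH1 W n ξ = 0) :
    ∃ (Q : geomPoints W) (hQ : n • Q ∈ MulAction.fixedPoints (absoluteGaloisGroup K) (geomPoints W)),
      ξ = kummerClassTorsion W n Q hQ := by
  obtain ⟨P, hP⟩ := mem_range_kummerMapTorsion_of_torsionH1ToH1_eq_zero W n
    (W.zsmul_geomPoints_surjective_of_charZero hn) ξ hξ
  exact ⟨_, _, hP.symm⟩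

omit hiso hPT in
/-- The `m`-th division of a point `Q` with `m • Q` rational: `Q₁` with `m • Q₁ = Q`, so that
`m² • Q₁ = m • Q` is rational. [folklore] -/
theorem exists_division (Q : geomPoints W)
    (hQ : (m : ℤ) • Q ∈ MulAction.fixedPoints (absoluteGaloisGroup K) (geomPoints W)) :
    ∃ (Q₁ : geomPoints W) (_ : ((m * m : ℕ) : ℤ) • Q₁ ∈
        MulAction.fixedPoints (absoluteGaloisGroup K) (geomPoints W)), (m : ℤ) • Q₁ = Q := by
  obtain ⟨Q₁, hQ₁⟩ := W.zsmul_geomPoints_surjective_of_charZero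
    (Int.natCast_ne_zero.mpr (NeZero.ne m)) Q
  have hQ₁' : (m : ℤ) • Q₁ = Q := hQ₁
  refine ⟨Q₁, ?_, hQ₁'⟩
  change ((m : ℤ) * (m : ℤ)) • Q₁ ∈ _
  rw [mul_zsmul, hQ₁']
  exact hQ

omit [NumberField K] [NeZero m] hiso hPT in
/-- `[m]_* κ_{m²}(Q₁) = κ_m(m Q₁)` for the global Kummer classes (tree
`map_torsionMulBy_kummerClassTorsion`, at the level `((m * m : ℕ) : ℤ)`). [folklore] -/
theorem map_mulK_kummerClassTorsion (Q₁ : geomPoints W)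
    (hQ₁ : ((m * m : ℕ) : ℤ) • Q₁ ∈ MulAction.fixedPoints (absoluteGaloisGroup K) (geomPoints W))
    (hQ : (m : ℤ) • ((m : ℤ) • Q₁) ∈ MulAction.fixedPoints (absoluteGaloisGroup K) (geomPoints W)) :
    galoisCohomology.map (mulK W m m) 1 (kummerClassTorsion W ((m * m : ℕ) : ℤ) Q₁ hQ₁) =
      kummerClassTorsion W (m : ℤ) ((m : ℤ) • Q₁) hQ :=
  W.map_torsionMulBy_kummerClassTorsion (m : ℤ) (m : ℤ) Q₁ hQ₁ hQ

omit hiso hPT in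
/-- The localisation of the global Kummer class `κ_{m²}(Q₁)` lies in the local Kummer condition.
[folklore] -/
theorem res_kummerClassTorsion_mem [W.IsElliptic] (E : Type u) [Field E] [Algebra K E] (Q₁ : geomPoints W)
    (hQ₁ : ((m * m : ℕ) : ℤ) • Q₁ ∈ MulAction.fixedPoints (absoluteGaloisGroup K) (geomPoints W)) :
    galoisCohomology.res (W.torsionGaloisModule ((m * m : ℕ) : ℤ)) E 1
        (kummerClassTorsion W ((m * m : ℕ) : ℤ) Q₁ hQ₁) ∈ W.kummerLocalConditionAt ((m * m : ℕ) : ℤ) E := by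
  rw [W.res_kummerClassTorsion ((m * m : ℕ) : ℤ) (Int.natCast_ne_zero.mpr (NeZero.ne (m * m))) Q₁ hQ₁
    (W.zsmul_pointsMap_mem_fixedPoints _ Q₁ hQ₁)]
  exact W.localKummerClass_mem_kummerLocalConditionAt _ _ _ _

/-- **Transport of the data along a Kummer class**: replacing `b` by `b + κ_m(Q)` (another Selmer
lift of the same `a`), `b₁` by `b₁ + κ_{m²}(Q₁)` (`m Q₁ = Q`) and `β_v` by `β_v + loc_v κ_{m²}(Q₁)`
gives data with the SAME local terms (`loc_v b₁ - β_v` is unchanged).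
[cite: MilneADT2006, Ch. I §6, proof of Prop. 6.9] -/
theorem value_eq_of_torsionH1ToH1_b_eq [W.IsElliptic] {D D₂ : FirstCaseData W m}
    (hb : torsionH1ToH1 W (m : ℤ) D.b = torsionH1ToH1 W (m : ℤ) D₂.b) (hb' : D.b' = D₂.b') :
    D.value e hμ hadd₁ hadd₂ hgal inv = D₂.value e hμ hadd₁ hadd₂ hgal inv := by
  -- `D₂.b - D.b = κ_m(Q)`, `Q = m Q₁`
  obtain ⟨Q, hQ, hκ⟩ := exists_eq_kummerClassTorsion_of_torsionH1ToH1_eq_zero (W := W)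
    (Int.natCast_ne_zero.mpr (NeZero.ne m)) (ξ := D₂.b - D.b) (by rw [torsionH1ToH1_sub', hb, sub_self])
  obtain ⟨Q₁, hQ₁, rfl⟩ := exists_division (W := W) (m := m) Q hQ
  set κ : galoisCohomology (W.torsionGaloisModule ((m * m : ℕ) : ℤ)) 1 :=
    kummerClassTorsion W ((m * m : ℕ) : ℤ) Q₁ hQ₁ with hκdef
  have hmapκ : galoisCohomology.map (mulK W m m) 1 κ = D₂.b - D.b := by
    rw [hκ]; exact map_mulK_kummerClassTorsion Q₁ hQ₁ hQ
  -- the transported data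
  let D₃ : FirstCaseData W m :=
    { b := D₂.b, b_mem := D₂.b_mem, b₁ := D.b₁ + κ
      map_b₁ := by rw [map_add, D.map_b₁, hmapκ, add_sub_cancel]
      β := fun v => D.β v +
        galoisCohomology.res (W.torsionGaloisModule ((m * m : ℕ) : ℤ)) (Place.Completion v) 1 κ
      β_mem := fun v => add_mem (D.β_mem v) (res_kummerClassTorsion_mem (Place.Completion v) Q₁ hQ₁)
      map_β := fun v => by
        rw [map_add, D.map_β, ← galoisCohomology.res_map_one, hmapκ, ← map_add, add_sub_cancel]
      b' := D.b', b'_mem := D.b'_mem, β' := D.β', β'_mem := D.β'_mem, map_β' := D.map_β' }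
  have h3 : D₃.value e hμ hadd₁ hadd₂ hgal inv = D.value e hμ hadd₁ hadd₂ hgal inv := by
    let S := D.badSet ∪ D₃.badSet
    rw [← D.sum_localTerm_eq_value inv hiso (Finset.subset_union_left (s₂ := D₃.badSet)),
      ← D₃.sum_localTerm_eq_value inv hiso (Finset.subset_union_right (s₁ := D.badSet))]
    refine Finset.sum_congr rfl fun v _ => ?_
    change ctLocalTerm W m (Place.Completion v) e hμ hadd₁ hadd₂ hgal (inv v) (D.b₁ + κ)
      (D.β v + galoisCohomology.res (W.torsionGaloisModule ((m * m : ℕ) : ℤ)) (Place.Completion v) 1 κ)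
      (D.β' v) = ctLocalTerm W m (Place.Completion v) e hμ hadd₁ hadd₂ hgal (inv v) D.b₁ (D.β v) (D.β' v)
    rw [ctLocalTerm_add_left, add_eq_left, ctLocalTerm, sub_self, map_zero, AddMonoidHom.zero_apply]
    exact map_zero _
  rw [← h3]
  exact value_eq_of_b_eq inv hiso hPT rfl hb'

/-! ## Independence of the Selmer lift `b'` of `a'` -/

omit [NumberField K] hiso hPT in
/-- `E[m²]` is finite (local instance). [folklore] -/
theorem finite_geomTorsion_level_sq [W.IsElliptic] : Finite (geomTorsion W ((m * m : ℕ) : ℤ)) :=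
  finite_geomTorsion_of_neZero W (m * m)

attribute [local instance] finite_geomTorsion_level_sq

omit hiso hPT in
/-- **The correction term of a change of `b'` by a Kummer class is a localised GLOBAL cup product**
plus an isotropic term: `inv_v(loc_v b₁ ∪_{m²} loc_v κ) = inv_v(loc_v(b₁ ∪_{m²} κ))`. [folklore] -/
theorem inv_weilLocalCup_res_res (v : Place K)
    (invE : galoisCohomology (GaloisRep.restrictField (Place.Completion v) (mu K (m * m))) 2 →+ ZMod (m * m))
    (x y : galoisCohomology (W.torsionGaloisModule ((m * m : ℕ) : ℤ)) 1) :
    invE (weilLocalCup W m (Place.Completion v) e hμ hadd₁ hadd₂ hgal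
        (galoisCohomology.res (W.torsionGaloisModule ((m * m : ℕ) : ℤ)) (Place.Completion v) 1 x)
        (galoisCohomology.res (W.torsionGaloisModule ((m * m : ℕ) : ℤ)) (Place.Completion v) 1 y)) =
      invE (galoisCohomology.localization (mu K (m * m)) v 2
        ((weilContPairing W (m * m) e hμ hadd₁ hadd₂ hgal).cupProduct x y)) := by
  congr 1
  exact (ContPairing.cupProduct_res (weilContPairing W (m * m) e hμ hadd₁ hadd₂ hgal)
    (absGaloisRestrict K (Place.Completion v)) x y).symm

/-- **Transport of the data along a Kummer class in the second variable**: replacing `b'` by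
`b' + κ_m(Q')` (another Selmer lift of the same `a'`) and `β'_v` by `β'_v + loc_v κ_{m²}(Q'₁)` changes
the local term by `inv_v((loc_v b₁ - β_v) ∪ loc_v κ_{m²}(Q'₁)) = inv_v(loc_v(b₁ ∪_{m²} κ_{m²}(Q'₁))) - 0`
(isotropy for `β_v ∪ loc_v κ`), whose sum over all places vanishes by Poitou–Tate for the GLOBAL
classes `b₁, κ_{m²}(Q'₁)`. Hence **the value depends only on `a = torsionH1ToH1 b` and
`a' = torsionH1ToH1 b'`.** [cite: MilneADT2006, Ch. I §6, proof of Prop. 6.9] -/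
theorem value_eq_of_torsionH1ToH1_eq [W.IsElliptic] {D D₂ : FirstCaseData W m}
    (hb : torsionH1ToH1 W (m : ℤ) D.b = torsionH1ToH1 W (m : ℤ) D₂.b)
    (hb' : torsionH1ToH1 W (m : ℤ) D.b' = torsionH1ToH1 W (m : ℤ) D₂.b') :
    D.value e hμ hadd₁ hadd₂ hgal inv = D₂.value e hμ hadd₁ hadd₂ hgal inv := by
  -- `D₂.b' - D.b' = κ_m(m Q₁)`
  obtain ⟨Q, hQ, hκ⟩ := exists_eq_kummerClassTorsion_of_torsionH1ToH1_eq_zero (W := W)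
    (Int.natCast_ne_zero.mpr (NeZero.ne m)) (ξ := D₂.b' - D.b') (by rw [torsionH1ToH1_sub', hb', sub_self])
  obtain ⟨Q₁, hQ₁, rfl⟩ := exists_division (W := W) (m := m) Q hQ
  set κ : galoisCohomology (W.torsionGaloisModule ((m * m : ℕ) : ℤ)) 1 :=
    kummerClassTorsion W ((m * m : ℕ) : ℤ) Q₁ hQ₁ with hκdef
  have hmapκ : galoisCohomology.map (mulK W m m) 1 κ = D₂.b' - D.b' := by
    rw [hκ]; exact map_mulK_kummerClassTorsion Q₁ hQ₁ hQ
  -- the transported data (second variable)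
  let D₃ : FirstCaseData W m :=
    { b := D.b, b_mem := D.b_mem, b₁ := D.b₁, map_b₁ := D.map_b₁, β := D.β, β_mem := D.β_mem
      map_β := D.map_β
      b' := D₂.b', b'_mem := D₂.b'_mem
      β' := fun v => D.β' v +
        galoisCohomology.res (W.torsionGaloisModule ((m * m : ℕ) : ℤ)) (Place.Completion v) 1 κ
      β'_mem := fun v => add_mem (D.β'_mem v) (res_kummerClassTorsion_mem (Place.Completion v) Q₁ hQ₁)
      map_β' := fun v => by
        rw [map_add, D.map_β', ← galoisCohomology.res_map_one, hmapκ, ← map_add, add_sub_cancel] }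
  have h3 : D₃.value e hμ hadd₁ hadd₂ hgal inv = D.value e hμ hadd₁ hadd₂ hgal inv := by
    let S := D.badSet ∪ D₃.badSet
    have hS : D.badSet ⊆ S := Finset.subset_union_left
    have hS₃ : D₃.badSet ⊆ S := Finset.subset_union_right
    rw [← D.sum_localTerm_eq_value inv hiso hS, ← D₃.sum_localTerm_eq_value inv hiso hS₃]
    -- termwise: `t³_v = t_v + inv_v(loc_v(b₁ ∪ κ))`
    have hterm : ∀ v, D₃.localTerm e hμ hadd₁ hadd₂ hgal inv v =
        D.localTerm e hμ hadd₁ hadd₂ hgal inv v +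
          inv v (galoisCohomology.localization (mu K (m * m)) v 2
            ((weilContPairing W (m * m) e hμ hadd₁ hadd₂ hgal).cupProduct D.b₁ κ)) := fun v => by
      change ctLocalTerm W m (Place.Completion v) e hμ hadd₁ hadd₂ hgal (inv v) D.b₁ (D.β v)
        (D.β' v + galoisCohomology.res (W.torsionGaloisModule ((m * m : ℕ) : ℤ)) (Place.Completion v) 1 κ)
        = ctLocalTerm W m (Place.Completion v) e hμ hadd₁ hadd₂ hgal (inv v) D.b₁ (D.β v) (D.β' v) + _
      rw [ctLocalTerm_add_right]
      congr 1
      rw [ctLocalTerm, map_sub, AddMonoidHom.sub_apply,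
        hiso v (D.β_mem v) (res_kummerClassTorsion_mem (Place.Completion v) Q₁ hQ₁), sub_zero]
      exact inv_weilLocalCup_res_res (W := W) (e := e) (hμ := hμ) (hadd₁ := hadd₁) (hadd₂ := hadd₂)
        (hgal := hgal) v (inv v) D.b₁ κ
    rw [Finset.sum_congr rfl fun v _ => hterm v, Finset.sum_add_distrib, add_eq_left]
    refine DiscreteGaloisModule.sum_inv_localization_cupProduct_pairing_eq_zero
      (ρ₁ := W.torsionGaloisModule ((m * m : ℕ) : ℤ)) (ρ₂ := W.torsionGaloisModule ((m * m : ℕ) : ℤ))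
      (B := weilPairingHom W (m * m) e hμ hadd₁ hadd₂)
      (weilContPairing W (m * m) e hμ hadd₁ hadd₂ hgal).toLin_smul inv hPT
      (fun P => AddSubgroup.torsionBy.nsmul P) D.b₁ κ S fun v hv => ?_
    have h1 := D.localTerm_eq_zero_of_not_mem_badSet inv hiso (fun h => hv (hS h))
    have h3 := D₃.localTerm_eq_zero_of_not_mem_badSet inv hiso (fun h => hv (hS₃ h))
    rw [hterm v, h1, zero_add] at h3
    exact h3
  rw [← h3]
  exact value_eq_of_torsionH1ToH1_b_eq inv hiso hPT hb rfl

/-! ## Existence of the data -/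

omit hiso hPT in
/-- **Local lifts exist**: a class in the local Kummer condition at level `m` lifts along `[m]` to a
class in the local Kummer condition at level `m²` (divide the point by `m` in `E(K̄_v)`:
`[m]_* κ_{m²}(Q₁) = κ_m(m Q₁)`). [cite: MilneADT2006, Ch. I §6, proof of Prop. 6.9] -/
theorem exists_local_lift [W.IsElliptic] (E : Type u) [Field E] [Algebra K E]
    {c : galoisCohomology (GaloisRep.restrictField E (W.torsionGaloisModule (m : ℤ))) 1}
    (hc : c ∈ W.kummerLocalConditionAt (m : ℤ) E) :
    ∃ β : galoisCohomology (GaloisRep.restrictField E (W.torsionGaloisModule ((m * m : ℕ) : ℤ))) 1,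
      β ∈ W.kummerLocalConditionAt ((m * m : ℕ) : ℤ) E ∧
        galoisCohomology.map ((mulK W m m).restrictField E) 1 β = c := by
  have hm : (m : ℤ) ≠ 0 := Int.natCast_ne_zero.mpr (NeZero.ne m)
  obtain ⟨Q, hQ, rfl⟩ := W.exists_eq_localKummerClass_of_mem (m : ℤ) hm hc
  obtain ⟨Q₁, hQ₁, -, hmap⟩ :=
    W.exists_map_torsionMulBy_localKummerClass_eq (m : ℤ) (m : ℤ) (mul_ne_zero hm hm) hm Q hQ
  exact ⟨W.localKummerClass ((m : ℤ) * (m : ℤ)) (mul_ne_zero hm hm) Q₁ hQ₁,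
    W.localKummerClass_mem_kummerLocalConditionAt _ _ Q₁ hQ₁, hmap⟩

omit hiso hPT in
/-- **Data exist** for any Selmer `b` admitting a global lift `b₁` along `[m]` (first case) and any
Selmer `b'`. [cite: MilneADT2006, Ch. I §6, proof of Prop. 6.9] -/
theorem exists_of_lift [W.IsElliptic] {b : galoisCohomology (W.torsionGaloisModule (m : ℤ)) 1}
    (hb : b ∈ selmerGroup W (m : ℤ)) {b₁ : galoisCohomology (W.torsionGaloisModule ((m * m : ℕ) : ℤ)) 1}
    (hb₁ : galoisCohomology.map (mulK W m m) 1 b₁ = b)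
    {b' : galoisCohomology (W.torsionGaloisModule (m : ℤ)) 1} (hb' : b' ∈ selmerGroup W (m : ℤ)) :
    ∃ D : FirstCaseData W m, D.b = b ∧ D.b₁ = b₁ ∧ D.b' = b' := by
  have hloc := (W.mem_selmerGroup_iff_forall_localization_mem (m : ℤ) b).mp hb
  have hloc' := (W.mem_selmerGroup_iff_forall_localization_mem (m : ℤ) b').mp hb'
  choose β hβmem hβmap using fun v => exists_local_lift (W := W) (m := m) (Place.Completion v) (hloc v)
  choose β' hβ'mem hβ'map using fun v => exists_local_lift (W := W) (m := m) (Place.Completion v) (hloc' v)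
  exact ⟨{ b := b, b_mem := hb, b₁ := b₁, map_b₁ := hb₁, β := β, β_mem := hβmem, map_β := hβmap
           b' := b', b'_mem := hb', β' := β', β'_mem := hβ'mem, map_β' := hβ'map }, rfl, rfl, rfl⟩

/-! ## Additivity -/

omit hPT in
/-- **Additivity in the second variable**: data sharing `(b, b₁, β)` add in `(b', β')`, and the
values add. [folklore] -/
theorem value_add_right [W.IsElliptic] (D D₂ : FirstCaseData W m) (hb₁ : D.b₁ = D₂.b₁) :
    ∃ D₃ : FirstCaseData W m, D₃.b = D.b ∧ D₃.b' = D.b' + D₂.b' ∧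
      D₃.value e hμ hadd₁ hadd₂ hgal inv =
        D.value e hμ hadd₁ hadd₂ hgal inv + D₂.value e hμ hadd₁ hadd₂ hgal inv := by
  let D₃ : FirstCaseData W m :=
    { b := D.b, b_mem := D.b_mem, b₁ := D.b₁, map_b₁ := D.map_b₁, β := D.β, β_mem := D.β_mem
      map_β := D.map_β
      b' := D.b' + D₂.b', b'_mem := add_mem D.b'_mem D₂.b'_mem, β' := fun v => D.β' v + D₂.β' v
      β'_mem := fun v => add_mem (D.β'_mem v) (D₂.β'_mem v)
      map_β' := fun v => by rw [map_add, D.map_β', D₂.map_β', map_add] }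
  refine ⟨D₃, rfl, rfl, ?_⟩
  let S := D.badSet ∪ D₂.badSet ∪ D₃.badSet
  rw [← D.sum_localTerm_eq_value inv hiso
      (Finset.subset_union_left.trans (Finset.subset_union_left (s₂ := D₃.badSet))),
    ← D₂.sum_localTerm_eq_value inv hiso
      (Finset.subset_union_right.trans (Finset.subset_union_left (s₂ := D₃.badSet))),
    ← D₃.sum_localTerm_eq_value inv hiso (Finset.subset_union_right (s₁ := D.badSet ∪ D₂.badSet)),
    ← Finset.sum_add_distrib]
  refine Finset.sum_congr rfl fun v _ => ?_
  change ctLocalTerm W m (Place.Completion v) e hμ hadd₁ hadd₂ hgal (inv v) D.b₁ (D.β v) (D.β' v + D₂.β' v) = _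
  rw [ctLocalTerm_add_right, localTerm, localTerm, ← hb₁]
  congr 1
  exact ctLocalTerm_congr_mid (inv v) (hiso v) D.b₁ (D.β_mem v) (D₂.β_mem v) (D₂.β'_mem v)

omit hPT in
/-- **Additivity in the first variable**: data sharing `(b', β')` add in `(b, b₁, β)`, and the values
add. [folklore] -/
theorem value_add_left [W.IsElliptic] (D D₂ : FirstCaseData W m) (hb' : D.b' = D₂.b') :
    ∃ D₃ : FirstCaseData W m, D₃.b = D.b + D₂.b ∧ D₃.b₁ = D.b₁ + D₂.b₁ ∧ D₃.b' = D.b' ∧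
      D₃.value e hμ hadd₁ hadd₂ hgal inv =
        D.value e hμ hadd₁ hadd₂ hgal inv + D₂.value e hμ hadd₁ hadd₂ hgal inv := by
  let D₃ : FirstCaseData W m :=
    { b := D.b + D₂.b, b_mem := add_mem D.b_mem D₂.b_mem, b₁ := D.b₁ + D₂.b₁
      map_b₁ := by rw [map_add, D.map_b₁, D₂.map_b₁]
      β := fun v => D.β v + D₂.β v, β_mem := fun v => add_mem (D.β_mem v) (D₂.β_mem v)
      map_β := fun v => by rw [map_add, D.map_β, D₂.map_β, map_add]
      b' := D.b', b'_mem := D.b'_mem, β' := D.β', β'_mem := D.β'_mem, map_β' := D.map_β' }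
  refine ⟨D₃, rfl, rfl, rfl, ?_⟩
  let S := D.badSet ∪ D₂.badSet ∪ D₃.badSet
  rw [← D.sum_localTerm_eq_value inv hiso
      (Finset.subset_union_left.trans (Finset.subset_union_left (s₂ := D₃.badSet))),
    ← D₂.sum_localTerm_eq_value inv hiso
      (Finset.subset_union_right.trans (Finset.subset_union_left (s₂ := D₃.badSet))),
    ← D₃.sum_localTerm_eq_value inv hiso (Finset.subset_union_right (s₁ := D.badSet ∪ D₂.badSet)),
    ← Finset.sum_add_distrib]
  refine Finset.sum_congr rfl fun v _ => ?_
  change ctLocalTerm W m (Place.Completion v) e hμ hadd₁ hadd₂ hgal (inv v) (D.b₁ + D₂.b₁) (D.β v + D₂.β v)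
    (D.β' v) = _
  rw [ctLocalTerm_add_left, localTerm, localTerm]
  congr 1
  refine ctLocalTerm_congr_right (inv v) D₂.b₁ ?_ ?_
  · rw [D₂.map_β, D₂.map_mulK_res_b₁]
  · rw [D.map_β', D₂.map_β', hb']

/-! ## Vanishing on `mШ` -/

omit hiso hPT in
/-- `[m]_*` maps the level-`m²` Selmer group into the level-`m` Selmer group
(`[m]_* κ_{m²}(Q₁) = κ_m(m Q₁)` locally). [folklore] -/
theorem map_mulK_mem_selmerGroup [W.IsElliptic]
    {b₀ : galoisCohomology (W.torsionGaloisModule ((m * m : ℕ) : ℤ)) 1}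
    (hb₀ : b₀ ∈ selmerGroup W ((m * m : ℕ) : ℤ)) :
    galoisCohomology.map (mulK W m m) 1 b₀ ∈ selmerGroup W (m : ℤ) := by
  have hm : (m : ℤ) ≠ 0 := Int.natCast_ne_zero.mpr (NeZero.ne m)
  have hmm : ((m * m : ℕ) : ℤ) ≠ 0 := Int.natCast_ne_zero.mpr (NeZero.ne (m * m))
  refine (W.mem_selmerGroup_iff_forall_localization_mem (m : ℤ) _).mpr fun v => ?_
  have hv := (W.mem_selmerGroup_iff_forall_localization_mem _ b₀).mp hb₀ v
  change galoisCohomology.res _ (Place.Completion v) 1 _ ∈ W.kummerLocalConditionAt (m : ℤ) (Place.Completion v)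
  rw [galoisCohomology.res_map_one]
  obtain ⟨Q, hQ, hQeq⟩ := W.exists_eq_localKummerClass_of_mem ((m * m : ℕ) : ℤ) hmm
    (c := galoisCohomology.res _ (Place.Completion v) 1 b₀) hv
  rw [hQeq]
  have hQ' : (m : ℤ) • ((m : ℤ) • Q) ∈
      MulAction.fixedPoints (absoluteGaloisGroup (Place.Completion v)) (localPoints W (Place.Completion v)) := by
    rw [← mul_zsmul]; exact hQ
  have h := W.map_torsionMulBy_localKummerClass (E := Place.Completion v) (m : ℤ) (m : ℤ)
    (mul_ne_zero hm hm) hm Q hQ hQ'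
  exact h ▸ W.localKummerClass_mem_kummerLocalConditionAt _ _ _ hQ'

omit hiso hPT in
/-- **The data of a divisible class**: for `b₀ ∈ Sel^{(m²)}(E/K)` (a Selmer lift of `a₀` with
`a = m a₀`), the data `b := [m]_* b₀`, `b₁ := b₀`, `β_v := loc_v b₀` (and any `b'`, `β'`) have ALL
local terms zero (`loc_v b₁ - β_v = 0`). [cite: MilneADT2006, Ch. I §6, proof of Prop. 6.9 and Thm. 6.13(a)] -/
theorem exists_of_selmer_sq [W.IsElliptic] {b₀ : galoisCohomology (W.torsionGaloisModule ((m * m : ℕ) : ℤ)) 1}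
    (hb₀ : b₀ ∈ selmerGroup W ((m * m : ℕ) : ℤ))
    {b' : galoisCohomology (W.torsionGaloisModule (m : ℤ)) 1} (hb' : b' ∈ selmerGroup W (m : ℤ)) :
    ∃ D : FirstCaseData W m, D.b = galoisCohomology.map (mulK W m m) 1 b₀ ∧ D.b' = b' ∧
      ∀ v, D.localTerm e hμ hadd₁ hadd₂ hgal inv v = 0 := by
  have hloc := (W.mem_selmerGroup_iff_forall_localization_mem _ b₀).mp hb₀
  have hloc' := (W.mem_selmerGroup_iff_forall_localization_mem (m : ℤ) b').mp hb'
  choose β' hβ'mem hβ'map using fun v => exists_local_lift (W := W) (m := m) (Place.Completion v) (hloc' v)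
  refine ⟨{ b := galoisCohomology.map (mulK W m m) 1 b₀, b_mem := map_mulK_mem_selmerGroup hb₀, b₁ := b₀
            map_b₁ := rfl
            β := fun v => galoisCohomology.res (W.torsionGaloisModule ((m * m : ℕ) : ℤ)) (Place.Completion v) 1 b₀
            β_mem := hloc, map_β := fun v => (galoisCohomology.res_map_one _ _ _).symm
            b' := b', b'_mem := hb', β' := β', β'_mem := hβ'mem, map_β' := hβ'map }, rfl, rfl, fun v => ?_⟩
  simp only [localTerm, ctLocalTerm, sub_self, map_zero, AddMonoidHom.zero_apply]

end FirstCaseData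

/-! ## The first-case pairing as a function of `(a, a')` -/

section Pairing

variable (e : geomTorsion W ((m * m : ℕ) : ℤ) → geomTorsion W ((m * m : ℕ) : ℤ) → AlgebraicClosure K)
  (hμ : ∀ S T, e S T ^ (m * m) = 1)
  (hadd₁ : ∀ S₁ S₂ T, e (S₁ + S₂) T = e S₁ T * e S₂ T)
  (hadd₂ : ∀ S T₁ T₂, e S (T₁ + T₂) = e S T₁ * e S T₂)
  (hgal : ∀ (σ : absoluteGaloisGroup K) (S T : geomTorsion W ((m * m : ℕ) : ℤ)),
    σ • e S T = e (σ • S) (σ • T))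
variable (inv : LocalInvariants K (m * m))

/-- **The first case of the Cassels–Tate pairing at level `m` as a function on `H¹(K, E) × H¹(K, E)`**
(with values in `ℤ/m²` through the chosen local invariants at level `m²`): the value of any
first-case data for `(a, a')` (independent of the data, `FirstCaseData.value_eq_of_torsionH1ToH1_eq`),
and `0` if there are none (i.e. unless `a ∈ Ш[m]` is in the first case and `a' ∈ Ш[m]`).
[cite: MilneADT2006, Ch. I §6, proof of Prop. 6.9] -/
def ctFirstCaseFun [W.IsElliptic] (a a' : W.galH1) : ZMod (m * m) :=
  if h : ∃ D : FirstCaseData W m, torsionH1ToH1 W (m : ℤ) D.b = a ∧ torsionH1ToH1 W (m : ℤ) D.b' = a'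
  then h.choose.value e hμ hadd₁ hadd₂ hgal inv else 0

variable {W m e hμ hadd₁ hadd₂ hgal}
variable (hiso : ∀ (v : Place K)
    ⦃x y : galoisCohomology (GaloisRep.restrictField (Place.Completion v)
      (W.torsionGaloisModule ((m * m : ℕ) : ℤ))) 1⦄,
    x ∈ W.kummerLocalConditionAt ((m * m : ℕ) : ℤ) (Place.Completion v) →
      y ∈ W.kummerLocalConditionAt ((m * m : ℕ) : ℤ) (Place.Completion v) →
        weilLocalCup W m (Place.Completion v) e hμ hadd₁ hadd₂ hgal x y = 0)
-- as above: `hPT` is the reciprocity predicate on `inv`, not a named fact.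
variable (hPT : inv.SumLocalTermEqZero)
include hiso hPT

/-- **Well-definedness**: the function computes the value of ANY data for `(a, a')`.
[cite: MilneADT2006, Ch. I §6, proof of Prop. 6.9] -/
theorem ctFirstCaseFun_eq [W.IsElliptic] (D : FirstCaseData W m) :
    ctFirstCaseFun W m e hμ hadd₁ hadd₂ hgal inv (torsionH1ToH1 W (m : ℤ) D.b) (torsionH1ToH1 W (m : ℤ) D.b') =
      D.value e hμ hadd₁ hadd₂ hgal inv := by
  have h : ∃ D₂ : FirstCaseData W m, torsionH1ToH1 W (m : ℤ) D₂.b = torsionH1ToH1 W (m : ℤ) D.b ∧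
      torsionH1ToH1 W (m : ℤ) D₂.b' = torsionH1ToH1 W (m : ℤ) D.b' := ⟨D, rfl, rfl⟩
  rw [ctFirstCaseFun, dif_pos h]
  exact FirstCaseData.value_eq_of_torsionH1ToH1_eq inv hiso hPT h.choose_spec.1 h.choose_spec.2

/-- **Additivity in the second variable** on pairs admitting data. [cite: MilneADT2006, Ch. I §6, proof of Prop. 6.9] -/
theorem ctFirstCaseFun_add_right [W.IsElliptic] {a a'₁ a'₂ : W.galH1}
    (h₁ : ∃ D : FirstCaseData W m, torsionH1ToH1 W (m : ℤ) D.b = a ∧ torsionH1ToH1 W (m : ℤ) D.b' = a'₁)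
    (h₂ : ∃ D : FirstCaseData W m, torsionH1ToH1 W (m : ℤ) D.b = a ∧ torsionH1ToH1 W (m : ℤ) D.b' = a'₂) :
    ctFirstCaseFun W m e hμ hadd₁ hadd₂ hgal inv a (a'₁ + a'₂) =
      ctFirstCaseFun W m e hμ hadd₁ hadd₂ hgal inv a a'₁ + ctFirstCaseFun W m e hμ hadd₁ hadd₂ hgal inv a a'₂ := by
  obtain ⟨D₁, rfl, rfl⟩ := h₁
  obtain ⟨D₂, -, rfl⟩ := h₂
  -- share the first-variable part of `D₁` (valid data for `(a, a'₂)`)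
  let D₂' : FirstCaseData W m :=
    { b := D₁.b, b_mem := D₁.b_mem, b₁ := D₁.b₁, map_b₁ := D₁.map_b₁, β := D₁.β, β_mem := D₁.β_mem
      map_β := D₁.map_β
      b' := D₂.b', b'_mem := D₂.b'_mem, β' := D₂.β', β'_mem := D₂.β'_mem, map_β' := D₂.map_β' }
  obtain ⟨D₃, h3b, h3b', h3v⟩ := FirstCaseData.value_add_right inv hiso D₁ D₂' rfl
  have e₂ : ctFirstCaseFun W m e hμ hadd₁ hadd₂ hgal inv (torsionH1ToH1 W (m : ℤ) D₁.b)
      (torsionH1ToH1 W (m : ℤ) D₂.b') = D₂'.value e hμ hadd₁ hadd₂ hgal inv :=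
    ctFirstCaseFun_eq inv hiso hPT D₂'
  have e₃ := ctFirstCaseFun_eq inv hiso hPT D₃
  rw [h3b, h3b', FirstCaseData.torsionH1ToH1_add'] at e₃
  rw [e₂, ctFirstCaseFun_eq inv hiso hPT D₁, ← h3v]
  exact e₃

/-- **Additivity in the first variable** on pairs admitting data. [cite: MilneADT2006, Ch. I §6, proof of Prop. 6.9] -/
theorem ctFirstCaseFun_add_left [W.IsElliptic] {a₁ a₂ a' : W.galH1}
    (h₁ : ∃ D : FirstCaseData W m, torsionH1ToH1 W (m : ℤ) D.b = a₁ ∧ torsionH1ToH1 W (m : ℤ) D.b' = a')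
    (h₂ : ∃ D : FirstCaseData W m, torsionH1ToH1 W (m : ℤ) D.b = a₂ ∧ torsionH1ToH1 W (m : ℤ) D.b' = a') :
    ctFirstCaseFun W m e hμ hadd₁ hadd₂ hgal inv (a₁ + a₂) a' =
      ctFirstCaseFun W m e hμ hadd₁ hadd₂ hgal inv a₁ a' + ctFirstCaseFun W m e hμ hadd₁ hadd₂ hgal inv a₂ a' := by
  obtain ⟨D₁, rfl, rfl⟩ := h₁
  obtain ⟨D₂, rfl, -⟩ := h₂
  -- share the second-variable part of `D₁` (valid data for `(a₂, a')`)
  let D₂' : FirstCaseData W m :=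
    { b := D₂.b, b_mem := D₂.b_mem, b₁ := D₂.b₁, map_b₁ := D₂.map_b₁, β := D₂.β, β_mem := D₂.β_mem
      map_β := D₂.map_β
      b' := D₁.b', b'_mem := D₁.b'_mem, β' := D₁.β', β'_mem := D₁.β'_mem, map_β' := D₁.map_β' }
  obtain ⟨D₃, h3b, -, h3b', h3v⟩ := FirstCaseData.value_add_left inv hiso D₁ D₂' rfl
  have e₂ : ctFirstCaseFun W m e hμ hadd₁ hadd₂ hgal inv (torsionH1ToH1 W (m : ℤ) D₂.b)
      (torsionH1ToH1 W (m : ℤ) D₁.b') = D₂'.value e hμ hadd₁ hadd₂ hgal inv :=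
    ctFirstCaseFun_eq inv hiso hPT D₂'
  have e₃ := ctFirstCaseFun_eq inv hiso hPT D₃
  rw [h3b, h3b', FirstCaseData.torsionH1ToH1_add'] at e₃
  rw [e₂, ctFirstCaseFun_eq inv hiso hPT D₁, ← h3v]
  exact e₃

omit [NumberField K] [NeZero m] hiso hPT in
/-- `H¹(K, E[m²]) →[m] H¹(K, E[m]) → H¹(K, E)` is `m` times `H¹(K, E[m²]) → H¹(K, E)`. [folklore] -/
theorem torsionH1ToH1_map_mulK (z : galoisCohomology (W.torsionGaloisModule ((m * m : ℕ) : ℤ)) 1) :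
    torsionH1ToH1 W (m : ℤ) (galoisCohomology.map (mulK W m m) 1 z) =
      (m : ℤ) • torsionH1ToH1 W ((m * m : ℕ) : ℤ) z := by
  obtain ⟨φ, rfl⟩ := oneCocycleClass_surjective (W.torsionGaloisModule ((m * m : ℕ) : ℤ)).toTopRep z
  rw [← cohomologyMap_torsionInclGaloisModuleHom_one, ← cohomologyMap_torsionInclGaloisModuleHom_one,
    ← DiscreteGaloisModule.cohomologyMap_homOfIntertwining, cohomologyMap_oneCocycleClass,
    cohomologyMap_oneCocycleClass, cohomologyMap_oneCocycleClass]
  have h1 : contOneCocycles.pullback (ContinuousMonoidHom.id _)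
        (resIdHom (W.torsionInclGaloisModuleHom (m : ℤ)))
        (contOneCocycles.pullback (ContinuousMonoidHom.id _)
          (resIdHom (DiscreteGaloisModule.homOfIntertwining (mulK W m m))) φ) =
      (m : ℤ) • contOneCocycles.pullback (ContinuousMonoidHom.id _)
        (resIdHom (W.torsionInclGaloisModuleHom ((m * m : ℕ) : ℤ))) φ :=
    Subtype.ext (ContinuousMap.ext fun σ => rfl)
  rw [h1]
  exact (oneCocycleClass_smul (X := W.galoisModule.toTopRep) (m : ℤ) _).trans
    (Int.cast_smul_eq_zsmul ℤ (m : ℤ) _)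

/-- **Vanishing on `mШ`**: if `a = m a₀` with `a₀ ∈ Ш(E/K)` killed by `m²`, then
`⟨a, a'⟩ = 0` for every `a' ∈ Ш[m]` (the data of the divisible class has all local terms zero).
[cite: MilneADT2006, Ch. I §6, proof of Prop. 6.9 and Thm. 6.13(a)] -/
theorem ctFirstCaseFun_eq_zero_of_eq_smul [W.IsElliptic] {a₀ a' : W.galH1} (ha₀ : a₀ ∈ W.sha)
    (hma₀ : (((m * m : ℕ) : ℤ)) • a₀ = 0) (ha' : a' ∈ W.sha) (hma' : (m : ℤ) • a' = 0) :
    ctFirstCaseFun W m e hμ hadd₁ hadd₂ hgal inv ((m : ℤ) • a₀) a' = 0 := by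
  have hmm : ((m * m : ℕ) : ℤ) ≠ 0 := Int.natCast_ne_zero.mpr (NeZero.ne (m * m))
  obtain ⟨b₀, hb₀, hb₀a⟩ := W.exists_mem_selmerGroup_kummerSelmerStructure_of_mem_sha _ hmm ha₀ hma₀
  obtain ⟨b', hb', hb'a⟩ := W.exists_mem_selmerGroup_kummerSelmerStructure_of_mem_sha _
    (Int.natCast_ne_zero.mpr (NeZero.ne m)) ha' hma'
  rw [← W.selmerGroup_eq_selmerGroup_kummerSelmerStructure] at hb₀ hb'
  obtain ⟨D, hDb, hDb', hD0⟩ := FirstCaseData.exists_of_selmer_sq (e := e) (hμ := hμ) (hadd₁ := hadd₁)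
    (hadd₂ := hadd₂) (hgal := hgal) inv hb₀ hb'
  have ha : torsionH1ToH1 W (m : ℤ) D.b = (m : ℤ) • a₀ := by rw [hDb, torsionH1ToH1_map_mulK, hb₀a]
  rw [← ha, ← hb'a, ← hDb', ctFirstCaseFun_eq inv hiso hPT D, FirstCaseData.value]
  exact Finset.sum_eq_zero fun v _ => hD0 v

omit hiso hPT in
/-- **Data exist in the first case**: for `a' ∈ Ш[m]` and a Selmer `b` (lifting `a`) that lifts along
`[m]`. [cite: MilneADT2006, Ch. I §6, proof of Prop. 6.9] -/
theorem exists_firstCaseData [W.IsElliptic] {b : galoisCohomology (W.torsionGaloisModule (m : ℤ)) 1}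
    (hb : b ∈ selmerGroup W (m : ℤ)) {b₁ : galoisCohomology (W.torsionGaloisModule ((m * m : ℕ) : ℤ)) 1}
    (hb₁ : galoisCohomology.map (mulK W m m) 1 b₁ = b) {a' : W.galH1} (ha' : a' ∈ W.sha)
    (hma' : (m : ℤ) • a' = 0) :
    ∃ D : FirstCaseData W m, torsionH1ToH1 W (m : ℤ) D.b = torsionH1ToH1 W (m : ℤ) b ∧
      torsionH1ToH1 W (m : ℤ) D.b' = a' := by
  obtain ⟨b', hb', rfl⟩ := W.exists_mem_selmerGroup_kummerSelmerStructure_of_mem_sha _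
    (Int.natCast_ne_zero.mpr (NeZero.ne m)) ha' hma'
  rw [← W.selmerGroup_eq_selmerGroup_kummerSelmerStructure] at hb'
  obtain ⟨D, rfl, -, rfl⟩ := FirstCaseData.exists_of_lift hb hb₁ hb'
  exact ⟨D, rfl, rfl⟩

end Pairing

end Literature.NumberTheory.EllipticCurves
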